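import Summits.RiemannHypothesis.RiemannHypothesis.Theorems.LiTailLaguerreDefs
import Summits.RiemannHypothesis.RiemannHypothesis.Theorems.LiPrimeEchoWindowAdjust
import Summits.RiemannHypothesis.RiemannHypothesis.Theorems.LiAsymptoticSmoothReplace
import HarnessLib

/-!
# RiemannHypothesis / LiTailLaguerre — Assembly support `LiTailAdjust`: moving the cut costs `O(log n)` (RH-FREE)

RH-FREE [rh-li-eng-4].  Route `Theses/LiTailLaguerre.lean` (rung «Li TAIL–LAGUERRE LAW» `LiTheory.LiZeroTailLaguerre`,
L-P(P1-tail); cell `pub/rh-li`, theory round 7, dossier `theory/route/r7/`), the registered skeleton statement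
`Sig.stub_tail_adjust` of the item `Assembly` (stmt-RiemannHypothesis-19706, birth stub `stub_tail_adjust`) VERBATIM:
for every `c > 0` there are `N`, `C` such that for `n ≥ N` and `c√n ≤ T ≤ c√n + 1`,

  `|liZeroTail n (c√n) − liZeroTail n T| ≤ C log n` and `|liSmoothTail n (c√n) − liSmoothTail n T| ≤ C log n`.

Proof.  ZERO TAIL: `liZeroTail n T = λ_n − (liZeroTrace 0 T − liZeroTrace n T)` (`liZeroTail_eq_trace`: the box sum of
`m(1 − zⁿ)` is the count trace minus the Li trace), so the difference of two cuts `a ≤ b` is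
`2 Σ_{a < Im ρ ≤ b} m (1 − Re z_ρⁿ)` (`WindowAdjust.liZeroTrace_sub_eq`), and for `Im ρ > a ≥ c√n`, WHATEVER the real part
`β ∈ [0, 1]` of the zero, `|z_ρ|² ≤ 1 + 1/γ² ≤ 1 + 1/(c² n)`, so `|z_ρⁿ| ≤ e^{1/(2c²)}` (`norm_pow_one_sub_inv_le_exp`);
the number of zeros (with multiplicity) in a unit height step is `≤ A log(T + 2)`
(`Montgomery.exists_zetaZeroCount_add_one_sub_le`, Riemann–von Mangoldt).  SMOOTH TAIL: the integrand
`f_n ϑ' = (1 − cos nθ) ϑ'` is integrable on every `Ioi a`, `a > 0` (`integrableOn_tail_integrand`: continuous, and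
`≤ (n²/2t²)(½ log t + 3) ≤ 2n² t^{−3/2}` beyond `max a 1`), so the two tails differ by `(2/π)∫_{c√n}^{T} f_n ϑ'`, a piece of
length `≤ 1` with `|f_n ϑ'| ≤ log t + 6`.  Nothing about the position of the zeros is used; nothing here bears on the truth
of RH.
-/

noncomputable section

-- D-0017: `Summit.<S>.<S>.…` is the designed namespace of a single-problem summit.
set_option linter.dupNamespace false

open Complex MeasureTheory intervalIntegral Set
open scoped Real ComplexConjugate Interval

namespace Summit.RiemannHypothesis.RiemannHypothesis.Theorems.LiTheory

open Literature.NumberTheory.LFunctions Literature.NumberTheory.LFunctions.SchoenfeldBound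

namespace TailAdjust

/-! ### The zero tail through the two traces -/

/-- `liZeroTail n T = λ_n − (liZeroTrace 0 T − liZeroTrace n T)`: the box sum of `m(1 − zⁿ)` is the count trace
(`n = 0`) minus the Li trace. -/
theorem liZeroTail_eq_trace (n : ℕ) (T : ℝ) :
    liZeroTail n T = keiperLiCoeff n - (liZeroTrace 0 T - liZeroTrace n T) := by
  unfold liZeroTail liZeroTrace
  congr 1
  rw [← Complex.sub_re, finsum_mem_eq_finite_toFinset_sum _ (liZeroBox_finite T),
    finsum_mem_eq_finite_toFinset_sum _ (liZeroBox_finite T),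
    finsum_mem_eq_finite_toFinset_sum _ (liZeroBox_finite T), ← Finset.sum_sub_distrib]
  congr 1
  refine Finset.sum_congr rfl fun ρ _ ↦ ?_
  rw [pow_zero, mul_sub]

/-- The count trace: `liZeroTrace 0 b − liZeroTrace 0 a = 2 (N(b) − N(a))` for `0 ≤ a ≤ b`. -/
theorem liZeroTrace_zero_sub_eq {a b : ℝ} (ha : 0 ≤ a) (hab : a ≤ b) :
    liZeroTrace 0 b - liZeroTrace 0 a = 2 * ((zetaZeroCount b : ℝ) - zetaZeroCount a) := by
  rw [WindowAdjust.liZeroTrace_sub_eq 0 ha hab, zetaZeroCount_sub_eq_sum hab]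
  congr 1
  refine Finset.sum_congr rfl fun ρ _ ↦ ?_
  rw [pow_zero, Complex.one_re, mul_one]

/-- The difference of two zero tails through the traces. -/
theorem liZeroTail_sub_eq (n : ℕ) (a b : ℝ) :
    liZeroTail n a - liZeroTail n b =
      (liZeroTrace 0 b - liZeroTrace 0 a) - (liZeroTrace n b - liZeroTrace n a) := by
  rw [liZeroTail_eq_trace, liZeroTail_eq_trace]; ring

/-! ### The Li weight of a zero of height `≥ c√n` is bounded, WHATEVER its real part -/

/-- For `Re ρ ≥ 0`, `Im ρ ≠ 0` and `n ≤ κ (Im ρ)²`: `‖(1 − 1/ρ)ⁿ‖ ≤ e^{κ/2}`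
(`|1 − 1/ρ|² = 1 + (1 − 2β)/|ρ|² ≤ 1 + 1/γ² ≤ 1 + κ/n`). -/
theorem norm_pow_one_sub_inv_le_exp (n : ℕ) {ρ : ℂ} {κ : ℝ} (h0 : 0 ≤ ρ.re) (hκ : 0 < κ)
    (him : ρ.im ≠ 0) (hγ : (n : ℝ) ≤ κ * ρ.im ^ 2) : ‖(1 - 1 / ρ) ^ n‖ ≤ Real.exp (κ / 2) := by
  rcases Nat.eq_zero_or_pos n with hn | hn
  · subst hn
    rw [pow_zero, norm_one]
    exact Real.one_le_exp_iff.2 (by positivity)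
  set β := ρ.re with hβ
  set γ := ρ.im with hγ'
  have hn0 : (0 : ℝ) < n := by exact_mod_cast hn
  have hγ2 : 0 < γ ^ 2 := by positivity
  have hN : Complex.normSq ρ = β ^ 2 + γ ^ 2 := by rw [Complex.normSq_apply]; ring
  have hNpos : 0 < Complex.normSq ρ := by rw [hN]; positivity
  have hρ0 : ρ ≠ 0 := fun h ↦ by rw [h, map_zero] at hNpos; exact lt_irrefl _ hNpos
  rw [norm_pow]
  set q := ‖1 - 1 / ρ‖ with hq
  have hq0 : 0 ≤ q := norm_nonneg _
  have hq2 : q ^ 2 = ((β - 1) ^ 2 + γ ^ 2) / (β ^ 2 + γ ^ 2) := by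
    have e : 1 - 1 / ρ = (ρ - 1) / ρ := by field_simp
    rw [hq, e, norm_div, div_pow, Complex.sq_norm, Complex.sq_norm, hN, Complex.normSq_apply]
    simp [hβ, hγ']
    ring
  have hq2le : q ^ 2 ≤ 1 + κ / n := by
    rw [hq2, div_le_iff₀ (by positivity)]
    have h1n : 1 ≤ κ / (n : ℝ) * (β ^ 2 + γ ^ 2) := by
      rw [div_mul_eq_mul_div, le_div_iff₀ hn0, one_mul]; nlinarith
    nlinarith
  have hexp : 1 + κ / (n : ℝ) ≤ Real.exp (κ / n) := by
    have := Real.add_one_le_exp (κ / (n : ℝ)); linarith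
  have hpow : (q ^ 2) ^ n ≤ Real.exp (κ / 2) ^ 2 := by
    calc (q ^ 2) ^ n ≤ (1 + κ / (n : ℝ)) ^ n := pow_le_pow_left₀ (sq_nonneg _) hq2le n
      _ ≤ Real.exp (κ / n) ^ n := pow_le_pow_left₀ (by positivity) hexp n
      _ = Real.exp κ := by rw [← Real.exp_nat_mul]; congr 1; field_simp
      _ = Real.exp (κ / 2) ^ 2 := by rw [← Real.exp_nat_mul]; congr 1; push_cast; ring
  have hsq : (q ^ n) ^ 2 ≤ Real.exp (κ / 2) ^ 2 := by rw [← pow_mul, mul_comm, pow_mul]; exact hpow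
  exact (pow_le_pow_iff_left₀ (pow_nonneg hq0 n) (Real.exp_pos _).le two_ne_zero).1 hsq

/-- **Li-trace step bound (RH-FREE):** for `n ≤ κ a²`, `0 < a ≤ b`,
`|liZeroTrace n b − liZeroTrace n a| ≤ 2 e^{κ/2} (N(b) − N(a))`. -/
theorem abs_liZeroTrace_sub_le_exp (n : ℕ) {a b κ : ℝ} (hκ : 0 < κ) (ha : (n : ℝ) ≤ κ * a ^ 2)
    (ha0 : 0 < a) (hab : a ≤ b) :
    |liZeroTrace n b - liZeroTrace n a| ≤
      2 * Real.exp (κ / 2) * ((zetaZeroCount b : ℝ) - zetaZeroCount a) := by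
  rw [WindowAdjust.liZeroTrace_sub_eq n ha0.le hab, zetaZeroCount_sub_eq_sum hab, abs_mul, abs_two, mul_assoc,
    Finset.mul_sum]
  refine mul_le_mul_of_nonneg_left ((Finset.abs_sum_le_sum_abs _ _).trans (Finset.sum_le_sum fun ρ hρ ↦ ?_))
    (by norm_num)
  obtain ⟨-, h0, -, h3, -⟩ := (mem_zerosBetween ha0.le).1 hρ
  have hm : (0 : ℝ) ≤ riemannZetaZeroOrder ρ := zeroOrder_nonneg_of_mem_zerosBetween ha0.le hρ
  have him : ρ.im ≠ 0 := (ha0.trans h3).ne'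
  have hγ : (n : ℝ) ≤ κ * ρ.im ^ 2 :=
    ha.trans (mul_le_mul_of_nonneg_left (pow_le_pow_left₀ ha0.le h3.le 2) hκ.le)
  rw [abs_mul, abs_of_nonneg hm, mul_comm (Real.exp _)]
  exact mul_le_mul_of_nonneg_left
    ((Complex.abs_re_le_norm _).trans (norm_pow_one_sub_inv_le_exp n h0 hκ him hγ)) hm

/-- **Zero-tail step bound (RH-FREE):** for `n ≤ κ a²`, `0 < a ≤ b`,
`|liZeroTail n a − liZeroTail n b| ≤ 2 (1 + e^{κ/2}) (N(b) − N(a))`. -/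
theorem abs_liZeroTail_sub_le (n : ℕ) {a b κ : ℝ} (hκ : 0 < κ) (ha : (n : ℝ) ≤ κ * a ^ 2)
    (ha0 : 0 < a) (hab : a ≤ b) :
    |liZeroTail n a - liZeroTail n b| ≤
      2 * (1 + Real.exp (κ / 2)) * ((zetaZeroCount b : ℝ) - zetaZeroCount a) := by
  rw [liZeroTail_sub_eq, liZeroTrace_zero_sub_eq ha0.le hab]
  have h := abs_liZeroTrace_sub_le_exp n hκ ha ha0 hab
  have hN : 0 ≤ (zetaZeroCount b : ℝ) - zetaZeroCount a :=
    sub_nonneg.2 (by exact_mod_cast zetaZeroCount_mono hab)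
  calc |2 * ((zetaZeroCount b : ℝ) - zetaZeroCount a) - (liZeroTrace n b - liZeroTrace n a)|
      ≤ |2 * ((zetaZeroCount b : ℝ) - zetaZeroCount a)| + |liZeroTrace n b - liZeroTrace n a| := abs_sub _ _
    _ ≤ 2 * ((zetaZeroCount b : ℝ) - zetaZeroCount a)
          + 2 * Real.exp (κ / 2) * ((zetaZeroCount b : ℝ) - zetaZeroCount a) :=
        add_le_add (by rw [abs_of_nonneg (by positivity)]) h
    _ = 2 * (1 + Real.exp (κ / 2)) * ((zetaZeroCount b : ℝ) - zetaZeroCount a) := by ring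

/-! ### The smooth tail: integrability and unit pieces -/

/-- The smooth-tail integrand `f_n ϑ'` is continuous away from `t = 0`. -/
theorem continuousOn_tail_integrand (n : ℕ) {s : Set ℝ} (hs : ∀ t ∈ s, t ≠ 0) :
    ContinuousOn (fun t ↦ liWindowWeight n t * liGammaDensity t) s := by
  have hϑ : Continuous liGammaDensity := by
    have : liGammaDensity = riemannSiegelThetaDeriv := funext WindowAdjust.liGammaDensity_eq
    rw [this]; exact continuous_riemannSiegelThetaDeriv_holds
  exact (SmoothReplace.continuousOn_liWindowWeight n hs).mul hϑ.continuousOn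

/-- Pointwise: `|f_n(t) ϑ'(t)| ≤ (n²/(2t²))(½ log t + 3) ≤ 2 n² t^{−3/2}` for `t ≥ 1`. -/
theorem norm_tail_integrand_le_rpow (n : ℕ) {t : ℝ} (ht : 1 ≤ t) :
    ‖liWindowWeight n t * liGammaDensity t‖ ≤ 2 * (n : ℝ) ^ 2 * t ^ (-(3 / 2 : ℝ)) := by
  have ht0 : 0 < t := by linarith
  rw [norm_mul, Real.norm_eq_abs, Real.norm_eq_abs]
  obtain ⟨hf0, -⟩ := SmoothReplace.liWindowWeight_mem n t
  have hf := SmoothReplace.liWindowWeight_le_sq n ht0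
  have hg := WindowAdjust.abs_liGammaDensity_le ht
  -- `log t ≤ 2 √t`, `1 ≤ √t`
  have hlog : Real.log t ≤ t ^ (1 / 2 : ℝ) / (1 / 2) := Real.log_le_rpow_div ht0.le one_half_pos
  have hone : 1 ≤ t ^ (1 / 2 : ℝ) := Real.one_le_rpow ht (by norm_num)
  have hg' : |liGammaDensity t| ≤ 4 * t ^ (1 / 2 : ℝ) := by linarith
  have hpow : t ^ (-(3 / 2 : ℝ)) = t ^ (1 / 2 : ℝ) / t ^ 2 := by
    rw [show (-(3 / 2 : ℝ)) = 1 / 2 - 2 by norm_num, Real.rpow_sub ht0, Real.rpow_two]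
  rw [abs_of_nonneg hf0, hpow]
  calc liWindowWeight n t * |liGammaDensity t| ≤ (n : ℝ) ^ 2 / (2 * t ^ 2) * (4 * t ^ (1 / 2 : ℝ)) :=
        mul_le_mul hf hg' (abs_nonneg _) (by positivity)
    _ = 2 * (n : ℝ) ^ 2 * (t ^ (1 / 2 : ℝ) / t ^ 2) := by
        field_simp
        ring

/-- **Integrability of the smooth-tail integrand** on every `Ioi a`, `a > 0` (continuous on `[a, max a 1]`,
dominated by `2n² t^{−3/2}` beyond). -/
theorem integrableOn_tail_integrand (n : ℕ) {a : ℝ} (ha : 0 < a) :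
    IntegrableOn (fun t ↦ liWindowWeight n t * liGammaDensity t) (Ioi a) := by
  set b := max a 1 with hb
  have hab : a ≤ b := le_max_left _ _
  have hb1 : 1 ≤ b := le_max_right _ _
  have hb0 : 0 < b := ha.trans_le hab
  rw [← Ioc_union_Ioi_eq_Ioi hab]
  refine IntegrableOn.union ?_ ?_
  · -- compact piece
    have hc : ContinuousOn (fun t ↦ liWindowWeight n t * liGammaDensity t) (Icc a b) :=
      continuousOn_tail_integrand n fun t ht ↦ (ha.trans_le ht.1).ne'
    exact (hc.integrableOn_compact isCompact_Icc).mono_set Ioc_subset_Icc_self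
  · -- dominated piece
    have hg : IntegrableOn (fun t : ℝ ↦ 2 * (n : ℝ) ^ 2 * t ^ (-(3 / 2 : ℝ))) (Ioi b) :=
      ((integrableOn_Ioi_rpow_of_lt (by norm_num) hb0).const_mul _)
    have hmeas : AEStronglyMeasurable (fun t ↦ liWindowWeight n t * liGammaDensity t)
        (volume.restrict (Ioi b)) :=
      (continuousOn_tail_integrand n fun t ht ↦ (hb0.trans ht).ne').aestronglyMeasurable measurableSet_Ioi
    refine Integrable.mono' hg hmeas (ae_restrict_of_forall_mem measurableSet_Ioi fun t ht ↦ ?_)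
    exact norm_tail_integrand_le_rpow n (hb1.trans ht.le)

/-- Moving the cut: `liSmoothTail n a − liSmoothTail n b = (2/π) ∫_a^b f_n ϑ'` for `0 < a ≤ b`. -/
theorem liSmoothTail_sub_eq (n : ℕ) {a b : ℝ} (ha : 0 < a) (hab : a ≤ b) :
    liSmoothTail n a - liSmoothTail n b =
      2 / Real.pi * ∫ t in a..b, liWindowWeight n t * liGammaDensity t := by
  have hint := integrableOn_tail_integrand n ha
  have hsplit : ∫ t in Ioi a, liWindowWeight n t * liGammaDensity t =
      (∫ t in Ioc a b, liWindowWeight n t * liGammaDensity t)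
        + ∫ t in Ioi b, liWindowWeight n t * liGammaDensity t := by
    rw [← setIntegral_union Ioc_disjoint_Ioi_same measurableSet_Ioi (hint.mono_set Ioc_subset_Ioi_self)
      (hint.mono_set (Ioi_subset_Ioi hab)), Ioc_union_Ioi_eq_Ioi hab]
  unfold liSmoothTail
  rw [← mul_sub, hsplit, intervalIntegral.integral_of_le hab]
  ring

/-- A unit piece of the smooth tail costs `≤ log(a + 1) + 6`: for `1 ≤ a ≤ a' ≤ a + 1`,
`|∫_a^{a'} f_n ϑ'| ≤ log(a + 1) + 6` (`0 ≤ f_n ≤ 2`, `|ϑ'(t)| ≤ ½ log t + 3`). -/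
theorem abs_integral_unit_le (n : ℕ) {a a' : ℝ} (ha : 1 ≤ a) (haa' : a ≤ a') (ha' : a' ≤ a + 1) :
    |∫ t in a..a', liWindowWeight n t * liGammaDensity t| ≤ Real.log (a + 1) + 6 := by
  have hpt : ∀ t ∈ Ι a a', ‖liWindowWeight n t * liGammaDensity t‖ ≤ Real.log (a + 1) + 6 := by
    intro t ht
    rw [uIoc_of_le haa'] at ht
    have ht1 : 1 ≤ t := by linarith [ht.1]
    rw [Real.norm_eq_abs, abs_mul]
    obtain ⟨hf0, hf2⟩ := SmoothReplace.liWindowWeight_mem n t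
    have hg := WindowAdjust.abs_liGammaDensity_le ht1
    have hlog : Real.log t ≤ Real.log (a + 1) := Real.log_le_log (by linarith) (by linarith [ht.2])
    rw [abs_of_nonneg hf0]
    calc liWindowWeight n t * |liGammaDensity t| ≤ 2 * (Real.log t / 2 + 3) :=
          mul_le_mul hf2 hg (abs_nonneg _) zero_le_two
      _ ≤ Real.log (a + 1) + 6 := by linarith
  have h := intervalIntegral.norm_integral_le_of_norm_le_const hpt
  rw [Real.norm_eq_abs, abs_of_nonneg (by linarith : (0 : ℝ) ≤ a' - a)] at h
  have hlen : a' - a ≤ 1 := by linarith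
  have hK : 0 ≤ Real.log (a + 1) + 6 := by
    have := Real.log_nonneg (by linarith : (1 : ℝ) ≤ a + 1); linarith
  calc |∫ t in a..a', liWindowWeight n t * liGammaDensity t|
      ≤ (Real.log (a + 1) + 6) * (a' - a) := h
    _ ≤ (Real.log (a + 1) + 6) * 1 := mul_le_mul_of_nonneg_left hlen hK
    _ = Real.log (a + 1) + 6 := mul_one _

end TailAdjust

open TailAdjust in
/-- **Assembly support `LiTailAdjust` of route `LiTailLaguerre` (registered skeleton statement `Sig.stub_tail_adjust`
of stmt-RiemannHypothesis-19706, birth stub `stub_tail_adjust`; RH-FREE):** for every `c > 0` there are `N`, `C` such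
that for `n ≥ N` and `c√n ≤ T ≤ c√n + 1`, moving the cut from `c√n` to `T` changes the zero tail and the smooth tail by at
most `C log n` each.  Verbatim the registered statement. -/
theorem liTailAdjust :
    ∀ c : ℝ, 0 < c → ∃ N : ℕ, ∃ C : ℝ, ∀ n : ℕ, N ≤ n → ∀ T : ℝ, c * Real.sqrt n ≤ T → T ≤ c * Real.sqrt n + 1 →
      |liZeroTail n (c * Real.sqrt n) - liZeroTail n T| ≤ C * Real.log n ∧
        |liSmoothTail n (c * Real.sqrt n) - liSmoothTail n T| ≤ C * Real.log n := by
  intro c hc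
  obtain ⟨A, hA0, hA⟩ := Montgomery.exists_zetaZeroCount_add_one_sub_le
  refine ⟨⌈(c + 2 + 1 / c) ^ 2⌉₊, 2 * (1 + Real.exp (1 / c ^ 2 / 2)) * A + 7, fun n hn T hTl hTu ↦ ?_⟩
  -- sizes
  have hc1 : 0 < 1 / c := one_div_pos.2 hc
  have hN : (c + 2 + 1 / c) ^ 2 ≤ (n : ℝ) := (Nat.le_ceil _).trans (by exact_mod_cast hn)
  set s := Real.sqrt n with hs
  have hn0 : (0 : ℝ) ≤ n := by positivity
  have hss : s ^ 2 = n := by rw [hs, Real.sq_sqrt hn0]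
  have hs3 : c + 2 + 1 / c ≤ s := by
    rw [hs, ← Real.sqrt_sq (by positivity : 0 ≤ c + 2 + 1 / c)]; exact Real.sqrt_le_sqrt hN
  have hs1 : 1 ≤ s := by linarith
  have hs0 : 0 < s := by linarith
  have hcs1 : 1 ≤ c * s := by
    have h1 : c * (1 / c) = 1 := mul_one_div_cancel hc.ne'
    nlinarith [mul_le_mul_of_nonneg_left hs3 hc.le]
  have hcs0 : 0 < c * s := by linarith
  -- `c s + 2 ≤ n`, `1 ≤ log n`
  have htop : c * s + 2 ≤ n := by
    have h1 : (c + 2) * s ≤ s * s := mul_le_mul_of_nonneg_right (by linarith) hs0.le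
    nlinarith
  have hn3 : (3 : ℝ) ≤ n := by linarith
  have hlogn1 : 1 ≤ Real.log n := by
    rw [Real.le_log_iff_exp_le (by linarith)]
    have := Real.exp_one_lt_d9; linarith
  have hlogn0 : 0 ≤ Real.log n := by linarith
  have hlog_cs : Real.log (c * s + 2) ≤ Real.log n := Real.log_le_log (by positivity) htop
  constructor
  · -- ZERO TAIL
    have hκ : 0 < 1 / c ^ 2 := by positivity
    have ha : (n : ℝ) ≤ 1 / c ^ 2 * (c * s) ^ 2 := by
      rw [mul_pow, ← mul_assoc, one_div_mul_cancel (by positivity), one_mul, hss]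
    have h1 := abs_liZeroTail_sub_le n hκ ha hcs0 hTl
    have hcount : (zetaZeroCount T : ℝ) - zetaZeroCount (c * s) ≤ A * Real.log n := by
      have hm : (zetaZeroCount T : ℝ) ≤ zetaZeroCount (c * s + 1) := by
        exact_mod_cast zetaZeroCount_mono hTu
      have := hA (c * s) hcs0.le
      nlinarith
    have he : 0 < 1 + Real.exp (1 / c ^ 2 / 2) := by positivity
    calc |liZeroTail n (c * s) - liZeroTail n T|
        ≤ 2 * (1 + Real.exp (1 / c ^ 2 / 2)) * ((zetaZeroCount T : ℝ) - zetaZeroCount (c * s)) := h1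
      _ ≤ 2 * (1 + Real.exp (1 / c ^ 2 / 2)) * (A * Real.log n) :=
          mul_le_mul_of_nonneg_left hcount (by positivity)
      _ = (2 * (1 + Real.exp (1 / c ^ 2 / 2)) * A) * Real.log n := by ring
      _ ≤ (2 * (1 + Real.exp (1 / c ^ 2 / 2)) * A + 7) * Real.log n := by nlinarith
  · -- SMOOTH TAIL
    rw [liSmoothTail_sub_eq n hcs0 hTl, abs_mul, abs_of_pos (by positivity : (0 : ℝ) < 2 / Real.pi)]
    have e1 := abs_integral_unit_le n hcs1 hTl hTu
    have hl1 : Real.log (c * s + 1) ≤ Real.log n :=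
      (Real.log_le_log (by positivity) (by linarith)).trans hlog_cs
    have hπ : 2 / Real.pi ≤ 1 := by rw [div_le_one Real.pi_pos]; linarith [Real.pi_gt_three]
    have h7 : Real.log (c * s + 1) + 6 ≤ 7 * Real.log n := by linarith
    have hA7 : 7 * Real.log n ≤ (2 * (1 + Real.exp (1 / c ^ 2 / 2)) * A + 7) * Real.log n := by
      have : 0 ≤ 2 * (1 + Real.exp (1 / c ^ 2 / 2)) * A * Real.log n := by positivity
      linarith
    calc 2 / Real.pi * |∫ t in (c * s)..T, liWindowWeight n t * liGammaDensity t|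
        ≤ 1 * (7 * Real.log n) := mul_le_mul hπ (e1.trans h7) (abs_nonneg _) zero_le_one
      _ ≤ (2 * (1 + Real.exp (1 / c ^ 2 / 2)) * A + 7) * Real.log n := by linarith

end Summit.RiemannHypothesis.RiemannHypothesis.Theorems.LiTheory

end
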